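import Summits.BirchSwinnertonDyer.BirchSwinnertonDyer.Theorems.EisensteinDepletionAtTwoStarGlueFin
import HarnessLib

/-!
# Route `EisensteinDepletionAtTwo`, crux E1M `DepletedLambdaLawAtTwoMod` (item stmt-BirchSwinnertonDyer-20341),
# line `star`, skeleton v3 — **(★-GlueFin) as REGISTERED**: `StarSymbC → StarEisEight → StarEisFin → StarCoreAtTwo`
# (all four unfolded over tree names), via SCALE PINNING `v₂(g′) = 3` and `sq_X_mul_red_pfree_eq_of_cuspCongruence8`

Cell `bsd-rank2`, seat `bsd-rank2-eng-2` GEN 8. THEOREMS ONLY — no definition, no named fact, no `sorry`. HONEST FRAMING: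
`Λ`-bookkeeping (curve side) for the lead's v3 composition of line `star`: the research cusp congruence (★-SymbC) (p2's C-test in
PRIMITIVE normalisations `g`, `g′`), the arithmetic input (★-EisEight) («`8 ∣ v` on `C`») and the finite-level Eisenstein half
(★-EisFin) (PROVED: `starEisFin`, p560388) enter as HYPOTHESES; the conclusion is (★-core) unfolded. Nothing here proves
(★-SymbC) or (★-EisEight); nothing reads an analytic rank; BSD is not proved by any of this (PARTITION D-0054: none — r_an ≥ 2
axis S0, door T-r3₂). SCALE PINNING: (★-EisEight) and the odd witness of (★-SymbC) give `v₂(g′) ≥ 3`; if `v₂(g′) ≥ 4` the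
`8`-normalised measure would be `≡ 0 (mod 2)` pointwise, hence so would all Riemann sums of its smoothing and, by (★-EisFin)(i),
`red H = 0` — contradicting (★-EisFin)(ii); so `g′/8 ∈ ℤ₂^×`, the primitive congruence IS the scale-`8` congruence, and
`sq_X_mul_red_pfree_eq_of_cuspCongruence8` applies.

* `norm_distributionRiemannSum_le_of_norm_le` (a bounded set function has bounded Riemann sums),
* **`starCore_of_symbC_eisEight_eisFin`** — closes `stub_starGlueFin` of `Cruxes/…/Lines/star.lean` v3 after
  `unfold StarGlueFin StarSymbC SameOnCModTwo StarEisEight StarEisFin StarCoreAtTwo frobeniusMinusOne` (the skeleton's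
  `InC`/`plusCuspDiff`/`stabEisCuspDiff`/`IsAdmissibleStabData`/`eisNormMeasure` ARE the tree's `…StarDefs` since v3).

References: B. Mazur, J. Tate, J. Teitelbaum, Invent. Math. 84 (1986), §I.10–I.13 [MazurTateTeitelbaum1986Invent]; G. Stevens,
*Arithmetic on Modular Curves* (1982), §5.4 [Stevens1982]; R. Greenberg, V. Vatsal, Invent. Math. 142 (2000), §3 Thm. (3.12) [GreenbergVatsal2000].
-/

set_option linter.dupNamespace false
set_option autoImplicit false

noncomputable section

open scoped Classical
open scoped MatrixGroups

open Filter Topology CongruenceSubgroup _root_.WeierstrassCurve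
  Literature.NumberTheory.EllipticCurves Literature.NumberTheory.EllipticCurves.ModularForms
  Literature.NumberTheory.EllipticCurves.Greenberg1999 Literature.NumberTheory.EllipticCurves.GreenbergVatsal2000
  Summit.BirchSwinnertonDyer.Rank1Residual.X1 Summit.BirchSwinnertonDyer.Rank1Residual.X1.MuLambda

namespace Summit.BirchSwinnertonDyer.BirchSwinnertonDyer.Theorems.DepletionAtTwo

/-- **A set function bounded by `C ≥ 0` has Riemann sums bounded by `C`** (at `p = 2`: the two `η`-halves, binomial weights are
integers, ultrametric inequality). [cite: MazurTateTeitelbaum1986Invent, §I.13] -/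
theorem norm_distributionRiemannSum_le_of_norm_le {μ : (n : ℕ) → ZMod (2 ^ n) → ℚ_[2]} {C : ℝ} (hC0 : 0 ≤ C)
    (hC : ∀ (n : ℕ) (a : ZMod (2 ^ n)), ‖μ n a‖ ≤ C) (k n : ℕ) : ‖distributionRiemannSum μ k n‖ ≤ C := by
  rw [distributionRiemannSum_two_eq_add μ k n]
  have hterm : ∀ (b : ZMod (2 ^ (n + 2))) (s : ZMod (2 ^ n)), ‖μ (n + 2) b * ((s.val.choose k : ℕ) : ℚ_[2])‖ ≤ C :=
    fun b s ↦ by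
    rw [norm_mul]
    calc ‖μ (n + 2) b‖ * ‖((s.val.choose k : ℕ) : ℚ_[2])‖ ≤ C * 1 :=
          mul_le_mul (hC _ _) (norm_cast_choose_le_one _ _) (norm_nonneg _) hC0
      _ = C := mul_one _
  exact norm_add_le_of_le_two (IsUltrametricDist.norm_sum_le_of_forall_le_of_nonneg hC0 fun s _ ↦ hterm _ s)
    (IsUltrametricDist.norm_sum_le_of_forall_le_of_nonneg hC0 fun s _ ↦ hterm _ s)

/-- **(★-GlueFin) as registered (v3): `StarSymbC → StarEisEight → StarEisFin → StarCoreAtTwo`**, unfolded over the tree's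
definitions. See the module docstring for the scale-pinning mechanism. [cite: GreenbergVatsal2000, §3 Thm. (3.12)]
[cite: Stevens1982, §5.4] [cite: MazurTateTeitelbaum1986Invent, §I.10–I.13] -/
theorem starCore_of_symbC_eisEight_eisFin
    (hS : ∀ (W : WeierstrassCurve ℚ) [W.IsElliptic] [W.IsGloballyMinimal] (x : ℚ), IsOrdinaryAt W 2 →
      HasUniqueRationalTwoTorsionX W x →
      ((TwoTorsionRamifiedAtTwo x ∧ ¬ TwoTorsionOdd W x) ∨ (TwoTorsionOdd W x ∧ ¬ TwoTorsionRamifiedAtTwo x)) →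
      ∀ ⦃N : ℕ⦄ [NeZero N] (f : CuspForm (Gamma0 N) 2), IsNewformOf W f →
        ∃ β : ℕ → ℕ, IsAdmissibleStabData (W.conductorNorm ℤ) β ∧
          ∃ g g' : ℚ, g ≠ 0 ∧ g' ≠ 0 ∧
            (∀ m a, InC m a → ∃ n n' : ℤ, plusCuspDiff f m a = n * g ∧
              stabEisCuspDiff (W.conductorNorm ℤ) β m a = n' * g' ∧ (n : ZMod 2) = (n' : ZMod 2)) ∧
            (∃ m a, InC m a ∧ ∃ n : ℤ, plusCuspDiff f m a = n * g ∧ Odd n))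
    (h8 : ∀ (N : ℕ), Odd N → ∀ (β : ℕ → ℕ), IsAdmissibleStabData N β →
      ∀ (m : ℕ) (a : ℤ), InC m a → ∃ n : ℤ, stabEisCuspDiff N β m a = n * 8)
    (hE : ∀ (N : ℕ), Odd N → ∀ (β : ℕ → ℕ), IsAdmissibleStabData N β →
      ∀ (cg : ℚ_[2]) (G₀ : IwasawaAlgebra 2), G₀ ≠ 0 →
        iwasawaToPowerSeries 2 G₀ = PowerSeries.C cg * klTwoNumerator →
      ∀ (ci : ℚ_[2]) (GI₀ : IwasawaAlgebra 2), GI₀ ≠ 0 →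
        iwasawaToPowerSeries 2 GI₀ = PowerSeries.C ci * klTwoNumeratorInv →
        ∃ (H : IwasawaAlgebra 2) (e : ℤ_[2]),
          (∀ k : ℕ, ∀ᶠ n in atTop,
            ‖distributionRiemannSum (stevensSmoothing 5 (eisNormMeasure N β 8)) k n -
                PowerSeries.coeff k (iwasawaToPowerSeries 2 H)‖ ≤ 2⁻¹) ∧
          red H = red (PowerSeries.binomialSeries ℤ_[2] e) * red (pfree G₀) * red (pfree GI₀) *
            ∏ ℓ ∈ N.primeFactors, red (frobeniusSeries 2 ℓ - 1) ^ N.factorization ℓ)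
    (W : WeierstrassCurve ℚ) [W.IsElliptic] [W.IsGloballyMinimal] (x : ℚ) (hord : IsOrdinaryAt W 2)
    (hx : HasUniqueRationalTwoTorsionX W x)
    (hAB : (TwoTorsionRamifiedAtTwo x ∧ ¬ TwoTorsionOdd W x) ∨ (TwoTorsionOdd W x ∧ ¬ TwoTorsionRamifiedAtTwo x))
    ⦃N : ℕ⦄ [NeZero N] (f : CuspForm (Gamma0 N) 2) (hf : IsNewformOf W f)
    (c : ℚ) (L₀ : IwasawaAlgebra 2) (hL₀ : L₀ ≠ 0)
    (hι : iwasawaToPowerSeries 2 L₀ = PowerSeries.C (c : ℚ_[2]) * padicLFunction f (unitRoot W 2 : ℚ_[2]))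
    (cg : ℚ_[2]) (G₀ : IwasawaAlgebra 2) (hG₀ : G₀ ≠ 0)
    (hιG : iwasawaToPowerSeries 2 G₀ = PowerSeries.C cg * klTwoNumerator)
    (ci : ℚ_[2]) (GI₀ : IwasawaAlgebra 2) (hGI₀ : GI₀ ≠ 0)
    (hιGI : iwasawaToPowerSeries 2 GI₀ = PowerSeries.C ci * klTwoNumeratorInv) :
    ∃ e : ℤ_[2],
      PowerSeries.X ^ 2 * red (pfree L₀) =
        red (PowerSeries.binomialSeries ℤ_[2] e) * red (pfree G₀) * red (pfree GI₀) *
          ∏ ℓ ∈ (W.conductorNorm ℤ).primeFactors,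
            red (frobeniusSeries 2 ℓ - 1) ^ (if (W.conductorNorm ℤ).factorization ℓ = 1 then 1 else 2) := by
  obtain ⟨β, hadm, g, g', hg, hg', hC, ⟨m₀, a₀, hma₀, n₀, hu₀, hn₀⟩⟩ := hS W x hord hx hAB f hf
  have h2N : ¬ 2 ∣ W.conductorNorm ℤ := not_dvd_conductorNorm_of_hasGoodReductionAtPrime W hord.1
  have hodd : Odd (W.conductorNorm ℤ) := Nat.odd_iff.mpr (Nat.two_dvd_ne_zero.mp h2N)
  obtain ⟨H, e₀, hH, hredH⟩ := hE (W.conductorNorm ℤ) hodd β hadm cg G₀ hG₀ hιG ci GI₀ hGI₀ hιGI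
  -- `red H ≠ 0`
  have hH0 : red H ≠ 0 := by
    rw [hredH]
    refine mul_ne_zero (mul_ne_zero (mul_ne_zero ?_ (red_pfree_ne_zero hG₀)) (red_pfree_ne_zero hGI₀))
      (Finset.prod_ne_zero_iff.mpr fun ℓ hℓ ↦ pow_ne_zero _ ?_)
    · intro h
      have := order_red_binomialSeries e₀
      rw [h, PowerSeries.order_zero] at this
      exact ENat.top_ne_zero this
    · have hℓp : ℓ.Prime := Nat.prime_of_mem_primeFactors hℓ
      have hℓ2 : ℓ ≠ 2 := fun h2 ↦ h2N (h2 ▸ Nat.dvd_of_mem_primeFactors hℓ)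
      exact red_frobeniusSeries_sub_one_ne_zero_two hℓp hℓ2
  -- SCALE PINNING, step 1: `‖g'/8‖ ≤ 1` from (★-EisEight) at the odd witness
  obtain ⟨n₁, n₁', hu₁, hv₁, hc₁⟩ := hC m₀ a₀ hma₀
  have hn₁ : n₁ = n₀ := by
    have h : (n₁ : ℚ) * g = n₀ * g := hu₁.symm.trans hu₀
    exact_mod_cast mul_right_cancel₀ hg h
  have hn₁'odd : Odd n₁' := by
    have hdvd : (2 : ℤ) ∣ n₁' - n₁ := by
      have := (ZMod.intCast_eq_intCast_iff_dvd_sub n₁ n₁' 2).mp hc₁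
      exact_mod_cast this
    obtain ⟨k, hk⟩ := hdvd
    have : n₁' = n₀ + 2 * k := by rw [← hn₁]; linear_combination hk
    rw [this]; exact hn₀.add_even (even_two_mul k)
  obtain ⟨z₀, hz₀⟩ := h8 (W.conductorNorm ℤ) hodd β hadm m₀ a₀ hma₀
  have hn₁'norm : ‖(n₁' : ℚ_[2])‖ = 1 := by
    rw [Padic.norm_intCast_eq_one_iff]
    exact (Int.isCoprime_iff_gcd_eq_one.mpr (by
      have : Int.gcd n₁' 2 = 1 := by
        rw [Int.gcd_comm]
        exact Int.isCoprime_iff_gcd_eq_one.mp ((Int.prime_two.coprime_iff_not_dvd).mpr (by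
          rintro ⟨k, hk⟩; rw [hk] at hn₁'odd; exact Int.not_even_iff_odd.mpr hn₁'odd (even_two_mul k))) 
      exact this))
  have hscale : ‖((g' / 8 : ℚ) : ℚ_[2])‖ ≤ 1 := by
    have hn0 : (n₁' : ℚ) ≠ 0 := by
      intro h0
      have : n₁' = 0 := by exact_mod_cast h0
      rw [this] at hn₁'odd; exact (by decide : ¬ Odd (0 : ℤ)) hn₁'odd
    have h : (g' : ℚ) / 8 = z₀ / n₁' := by
      rw [eq_div_iff hn0, div_mul_eq_mul_div, div_eq_iff (by norm_num : (8 : ℚ) ≠ 0)]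
      linear_combination -(hz₀.symm.trans hv₁)
    rw [h]; push_cast
    rw [norm_div, hn₁'norm, div_one]
    exact Padic.norm_int_le_one z₀
  -- the scale-8 congruence holds, OR the 8-normalised measure is `≡ 0 (mod 2)` everywhere
  by_cases hunit : ‖((g' / 8 : ℚ) : ℚ_[2])‖ = 1
  · -- Case A: `g'/8 ∈ ℤ₂ˣ`; the primitive congruence is the scale-8 congruence
    have hg81 : ‖((g' / 8 : ℚ) : ℚ_[2]) - 1‖ ≤ 2⁻¹ := by
      set w : ℤ_[2] := ⟨((g' / 8 : ℚ) : ℚ_[2]), hscale⟩ with hw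
      have hwn : ‖w‖ = 1 := by rw [PadicInt.norm_def]; exact hunit
      have hu : IsUnit w := PadicInt.isUnit_iff.mpr hwn
      have h := norm_units_sub_one_le_half hu.unit
      rwa [IsUnit.unit_spec] at h
    have hC8 : ∀ (m : ℕ) (a : ℤ), 3 ≤ m → a % 4 = 1 → 1 < a → a < 2 ^ m →
        ∃ n : ℤ, ratPlusSymbol f ((a : ℚ) / (2 ^ m : ℕ)) - ratPlusSymbol f (1 / (2 ^ m : ℕ)) = n * g ∧
          ‖(n : ℚ_[2]) - ((stabEisCuspDiff (W.conductorNorm ℤ) β m a / 8 : ℚ) : ℚ_[2])‖ ≤ 2⁻¹ := by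
      intro m a h3 h4 h1 hlt
      obtain ⟨n, n', hu, hv, hc⟩ := hC m a ⟨h3, h4, h1, hlt⟩
      refine ⟨n, hu, ?_⟩
      rw [hv, show (((n' : ℚ) * g' / 8 : ℚ) : ℚ_[2]) = (n' : ℚ_[2]) * ((g' / 8 : ℚ) : ℚ_[2]) by push_cast; ring,
        show (n : ℚ_[2]) - (n' : ℚ_[2]) * ((g' / 8 : ℚ) : ℚ_[2]) =
          ((n : ℚ_[2]) - n') + (n' : ℚ_[2]) * (1 - ((g' / 8 : ℚ) : ℚ_[2])) by ring]
      refine norm_add_le_of_le_two (norm_intCast_sub_le_half_of_zmod_eq hc) ?_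
      rw [norm_mul, norm_sub_rev]
      calc ‖(n' : ℚ_[2])‖ * ‖((g' / 8 : ℚ) : ℚ_[2]) - 1‖ ≤ 1 * 2⁻¹ :=
            mul_le_mul (Padic.norm_int_le_one n') hg81 (norm_nonneg _) zero_le_one
        _ = 2⁻¹ := one_mul _
    have hglue := sq_X_mul_red_pfree_eq_of_cuspCongruence8 f hord hf (stabEisCuspDiff (W.conductorNorm ℤ) β)
      (stabEisCuspDiff_one (W.conductorNorm ℤ) β) g hg hC8 H (fun k ↦ hH k) hH0 hL₀ hι
    refine ⟨1 + e₀, ?_⟩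
    have hprod : ∏ ℓ ∈ (W.conductorNorm ℤ).primeFactors,
        red (frobeniusSeries 2 ℓ - 1) ^ (W.conductorNorm ℤ).factorization ℓ =
        ∏ ℓ ∈ (W.conductorNorm ℤ).primeFactors,
          red (frobeniusSeries 2 ℓ - 1) ^ (if (W.conductorNorm ℤ).factorization ℓ = 1 then 1 else 2) := by
      refine Finset.prod_congr rfl fun ℓ hℓ ↦ ?_
      rcases factorization_eq_one_or_two_of_admissible hadm hℓ with h1 | h2
      · rw [if_pos h1, h1]
      · rw [if_neg (by omega), h2]
    rw [hglue, hredH, PowerSeries.binomialSeries_add, red_mul', hprod]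
    ring
  · -- Case B: `‖g'/8‖ < 1`, impossible: the `8`-normalised measure is `≡ 0 (mod 2)` pointwise, so `red H = 0`
    exfalso
    have hlt : ‖((g' / 8 : ℚ) : ℚ_[2])‖ ≤ 2⁻¹ := by
      have h := lt_of_le_of_ne hscale hunit
      have := (Padic.norm_le_pow_iff_norm_lt_pow_add_one ((g' / 8 : ℚ) : ℚ_[2]) (-1)).mpr (by simpa using h)
      simpa using this
    -- every value `v(m, b)/8`, `b ≡ 1 (4)`, `1 ≤ b < 2^m`, `m ≥ 3`, has norm `≤ 1/2`
    have hv8 : ∀ (m : ℕ) (b : ℤ), 3 ≤ m → b % 4 = 1 → 1 ≤ b → b < 2 ^ m →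
        ‖((stabEisCuspDiff (W.conductorNorm ℤ) β m b / 8 : ℚ) : ℚ_[2])‖ ≤ 2⁻¹ := by
      intro m b h3 h4 h1 hb
      rcases eq_or_lt_of_le h1 with h1 | h1
      · rw [← h1, stabEisCuspDiff_one]; simp
      · obtain ⟨n, n', -, hv, -⟩ := hC m b ⟨h3, h4, h1, hb⟩
        rw [hv, show (((n' : ℚ) * g' / 8 : ℚ) : ℚ_[2]) = (n' : ℚ_[2]) * ((g' / 8 : ℚ) : ℚ_[2]) by push_cast; ring,
          norm_mul]
        calc ‖(n' : ℚ_[2])‖ * ‖((g' / 8 : ℚ) : ℚ_[2])‖ ≤ 1 * 2⁻¹ :=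
              mul_le_mul (Padic.norm_int_le_one n') hlt (norm_nonneg _) zero_le_one
          _ = 2⁻¹ := one_mul _
    have hν : ∀ (m : ℕ) (b : ZMod (2 ^ m)), ‖eisNormMeasure (W.conductorNorm ℤ) β 8 m b‖ ≤ 2⁻¹ := by
      intro m b
      by_cases hmb : 4 ≤ m ∧ b.val % 4 = 1
      · rw [eisNormMeasure_of _ _ _ hmb]
        have hblt : b.val < 2 ^ m := ZMod.val_lt b
        have h4 : 4 ∣ 2 ^ (m - 1) := by
          have := pow_dvd_pow 2 (show 2 ≤ m - 1 by omega); simpa using this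
        have hbar4 : (b.val % 2 ^ (m - 1)) % 4 = 1 := by rw [Nat.mod_mod_of_dvd _ h4]; exact hmb.2
        have hbarlt : b.val % 2 ^ (m - 1) < 2 ^ (m - 1) := Nat.mod_lt _ (pow_pos two_pos _)
        have e : (((stabEisCuspDiff (W.conductorNorm ℤ) β m (b.val : ℤ) -
            stabEisCuspDiff (W.conductorNorm ℤ) β (m - 1) ((b.val % 2 ^ (m - 1) : ℕ) : ℤ)) / 8 : ℚ) : ℚ_[2]) =
            ((stabEisCuspDiff (W.conductorNorm ℤ) β m (b.val : ℤ) / 8 : ℚ) : ℚ_[2]) -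
              ((stabEisCuspDiff (W.conductorNorm ℤ) β (m - 1) ((b.val % 2 ^ (m - 1) : ℕ) : ℤ) / 8 : ℚ) : ℚ_[2]) := by
          push_cast; ring
        rw [e]
        refine norm_sub_le_of_le_two (hv8 m b.val (by omega) (by omega) (by omega) (by exact_mod_cast hblt))
          (hv8 (m - 1) _ (by omega) (by omega) (by omega) (by exact_mod_cast hbarlt))
      · rw [eisNormMeasure_of_not _ _ _ hmb, norm_zero]; norm_num
    have hSm : ∀ (m : ℕ) (b : ZMod (2 ^ m)),
        ‖stevensSmoothing 5 (eisNormMeasure (W.conductorNorm ℤ) β 8) m b‖ ≤ 2⁻¹ := norm_stevensSmoothing_le hν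
    have hRS : ∀ k n, ‖distributionRiemannSum (stevensSmoothing 5 (eisNormMeasure (W.conductorNorm ℤ) β 8)) k n‖ ≤ 2⁻¹ :=
      norm_distributionRiemannSum_le_of_norm_le (by norm_num) hSm
    have hcoeff : ∀ k, ‖PowerSeries.coeff k (iwasawaToPowerSeries 2 H)‖ ≤ 2⁻¹ := by
      intro k
      obtain ⟨n, hn⟩ := (hH k).exists
      have : PowerSeries.coeff k (iwasawaToPowerSeries 2 H) =
          distributionRiemannSum (stevensSmoothing 5 (eisNormMeasure (W.conductorNorm ℤ) β 8)) k n -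
            (distributionRiemannSum (stevensSmoothing 5 (eisNormMeasure (W.conductorNorm ℤ) β 8)) k n -
              PowerSeries.coeff k (iwasawaToPowerSeries 2 H)) := by ring
      rw [this]
      exact norm_sub_le_of_le_two (hRS k n) hn
    apply hH0
    have : red H = red 0 := by
      refine red_eq_red_of_norm_coeff_sub_lt_one fun k ↦ ?_
      rw [map_zero, sub_zero]
      have h := hcoeff k
      rw [PowerSeries.coeff_map, PadicInt.algebraMap_apply, PadicInt.padic_norm_e_of_padicInt] at h
      exact h.trans_lt (by norm_num)
    rw [this]; unfold red; rw [map_zero]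

end Summit.BirchSwinnertonDyer.BirchSwinnertonDyer.Theorems.DepletionAtTwo

end
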